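import Summits.BirchSwinnertonDyer.BirchSwinnertonDyer.Theorems.ManinLocalTwoThreeKummerMinimalDictionaryPrelims
import Summits.BirchSwinnertonDyer.BirchSwinnertonDyer.Theorems.ManinLocalTwoThreeMinimalCubeRootIntegral
import HarnessLib

/-!
# The HALF-POINT PARAMETER `t_W(c'·ℰ_f)` (halving line, C2 `ManinOddAtFour` stmt-BirchSwinnertonDyer-22967; cell bsd-f2-manin, prover p2 gen 20;
# LEAD-MEMO v38 «halving_udc», pieces (INT)/(DICT) and the `Γ^{(2)}`-periodicity of the port of `stub_halvingWitnessLaw`)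

For ANY integer multiplier `m` (the halving line uses `m = c' = c/2`), the parameter of the MINIMAL model at the point `m·ℰ_f(τ) mod Λ_W` is the
tree's total function `locT D.L (W/ℂ) (m·ℰ_f(τ))` (`t = −x/y` along the uniformisation, `0` on `Λ`).  PROVED here (no definition, no sorry):
* `exists_qGerm_locT_intMul` — `Z_m := locT ∘ (m·ε)` is an analytic `q`-germ, `Z_m(0) = 0`, `𝓣[Z_m] = exp_W(m·Σ aₙqⁿ/n) ⊗ ℂ`, `Z_m(𝕢₁τ) = t_W(m·ℰ_f τ)`
  (the tree's `exists_qGerm_minimalParam` with `c ↦ m`, proof verbatim);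
* `exists_hasSum_locT_intMul` — (DICT) near `i∞`: `Σ gₙ 𝕢₁(τ)ⁿ = t_W(m·ℰ_f τ)` for `Im τ > B`, `g = exp_W(m·Σ aₙqⁿ/n)`;
* `exists_int_coeff_expSeries_intMul` — (INT) `g ∈ ℤ⟦q⟧` (Honda at the integer `m`: tree `exists_int_coeff_formalExp_subst_lSeriesLog`);
* `locT_add_of_mem_lattice` — `t` is `Λ`-periodic; `locT_halfMul_gamma_smul` — for `c = 2c'` and `γ ∈ Γ^{(2)}` (`c·{∞,γ∞}_f ∈ 2Λ_W`):
  `t_W(c'·ℰ_f(γτ)) = t_W(c'·ℰ_f(τ))`; `locT_halfMul_gamma_smul_eq_add` — in general `c'·ℰ_f(γτ) = c'·ℰ_f(τ) + c'·{∞,γ∞}_f` with `2·(c'·{∞,γ∞}_f) ∈ Λ_W`.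
HONEST FRAMING: bookkeeping for the OPEN stub `stub_halvingWitnessLaw` (the holomorphic extension, the exact stabiliser, growth and the assembly are NOT here);
C2, Manin's conjecture and BSD are not proved. [cite: Honda1970, Thm. 9] [cite: SilvermanAEC2009, IV.1] [cite: Manin1972, Prop. 1.4 (shape)]
-/

set_option autoImplicit false
-- lint-debt: the directory name repeats the summit name (sibling precedent `ManinLocalTwoThreeKummerMinimalDictionaryPrelims.lean`)
set_option linter.dupNamespace false

noncomputable section

open scoped Topology PeriodPair MatrixGroups
open Complex Filter PowerSeries CongruenceSubgroup
open UpperHalfPlane hiding I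
open WeierstrassCurve Literature.NumberTheory.EllipticCurves Literature.NumberTheory.EllipticCurves.ModularForms
open Summit.BirchSwinnertonDyer.Rank1Residual.ManinAdditive.CuspidalKummer
open Summit.BirchSwinnertonDyer.Rank1Residual.ManinAdditive.CuspidalKummerThree
open Summit.BirchSwinnertonDyer.Rank1Residual.ManinAdditive.KummerCubeMonodromy
open Summit.BirchSwinnertonDyer.BirchSwinnertonDyer.Theorems.ManinLocalTwoThree.KummerCubeAnalytic
open Summit.BirchSwinnertonDyer.BirchSwinnertonDyer.Theorems.ManinLocalTwoThree.KummerCubeSigmaLeaves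

namespace Summit.BirchSwinnertonDyer.BirchSwinnertonDyer.Theorems.ManinLocalTwoThree.HalvingParam

/-! ## §1 The parameter at an integer multiple of the Eichler integral as an analytic `q`-germ -/

/-- **`Z_m = t_{W,Λ} ∘ (m·ε)` is an analytic `q`-germ** with `Z_m(0) = 0`, `𝓣[Z_m] = exp_W(m·Σ aₙqⁿ/n)` and `Z_m(𝕢₁τ) = t_W(m·ℰ_f(τ))` — for ANY integer
`m` (the tree's `exists_qGerm_minimalParam` is `m = c`). [cite: SilvermanAEC2009, IV.1] -/
theorem exists_qGerm_locT_intMul (W : WeierstrassCurve ℚ) [W.IsElliptic] {N : ℕ} [NeZero N]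
    (D : ModularParametrizationData W N) (a : ℕ → ℤ) (ha : ∀ n, (a n : ℂ) = cuspCoeff D.f n) (m : ℤ) :
    ∃ Z : ℂ → ℂ, AnalyticAt ℂ Z 0 ∧ Z 0 = 0 ∧
      taylorAt0 Z = PowerSeries.map (algebraMap ℚ ℂ) (W.formalExp.subst ((m : ℚ) • lSeriesLog a) : ℚ⟦X⟧) ∧
      ∀ τ : ℍ, Z (Function.Periodic.qParam 1 (τ : ℂ)) = locT D.L (W.baseChange ℂ) ((m : ℂ) * eichlerIntegral D.f τ) := by
  set V := W.baseChange ℂ with hV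
  obtain ⟨h₂, h₃⟩ := D.isNeronLattice
  rw [← hV] at h₂ h₃
  set ε : ℂ → ℂ := fun q => (m : ℂ) * qGerm D.f q with hεdef
  have hε : AnalyticAt ℂ ε 0 := analyticAt_const.mul (analyticAt_qGerm D.f)
  have hε0 : ε 0 = 0 := by simp [hεdef, qGerm_zero]
  have hta : AnalyticAt ℂ (locT D.L V) 0 := analyticAt_locT D.L V
  refine ⟨locT D.L V ∘ ε, ?_, ?_, ?_, ?_⟩
  · have h' : AnalyticAt ℂ (locT D.L V) (ε 0) := by rw [hε0]; exact hta
    exact h'.comp hε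
  · rw [Function.comp_apply, hε0, locT_zero]
  · have hTε : taylorAt0 ε = C (m : ℂ) * taylorAt0 (qGerm D.f) := by
      rw [hεdef]
      exact Literature.NumberTheory.Transcendental.AndreCriterion.taylor_const_mul (m : ℂ) (qGerm D.f)
    have hcL0 : constantCoeff ((m : ℚ) • lSeriesLog a) = 0 := by
      rw [← coeff_zero_eq_constantCoeff_apply, coeff_smul, coeff_zero_eq_constantCoeff_apply, lSeriesLog,
        ← coeff_zero_eq_constantCoeff_apply, coeff_mk]
      simp
    have hsQ : HasSubst ((m : ℚ) • lSeriesLog a) := HasSubst.of_constantCoeff_zero' hcL0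
    have hmapL : ((m : ℚ) • lSeriesLog a).map (algebraMap ℚ ℂ) = C (m : ℂ) * taylorAt0 (qGerm D.f) := by
      rw [taylorAt0_qGerm]
      ext n
      rw [coeff_map, coeff_smul, coeff_C_mul, lSeriesLog, coeff_mk, coeff_mk, ← ha n, smul_eq_mul]
      simp
    rw [taylorAt0_comp hta hε hε0, taylorAt0_locT D.L V h₂ h₃, hTε, map_subst_univ hsQ, hmapL, hV,
      WeierstrassCurve.baseChange, WeierstrassCurve.map_formalExp]
  · intro τ
    simp [hεdef, qGerm_apply]

/-- **(DICT) near `i∞`**: `Σₙ gₙ 𝕢₁(τ)ⁿ = t_W(m·ℰ_f(τ))` for `Im τ > B`, where `g = exp_W(m·Σ aₙqⁿ/n)`. [cite: SilvermanAEC2009, IV.1] -/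
theorem exists_hasSum_locT_intMul (W : WeierstrassCurve ℚ) [W.IsElliptic] {N : ℕ} [NeZero N]
    (D : ModularParametrizationData W N) (a : ℕ → ℤ) (ha : ∀ n, (a n : ℂ) = cuspCoeff D.f n) (m : ℤ) :
    ∃ B : ℝ, ∀ τ : ℍ, B < τ.im →
      HasSum (fun n : ℕ ↦ ((coeff n (W.formalExp.subst ((m : ℚ) • lSeriesLog a)) : ℚ) : ℂ) * Function.Periodic.qParam 1 (τ : ℂ) ^ n)
        (locT D.L (W.baseChange ℂ) ((m : ℂ) * eichlerIntegral D.f τ)) := by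
  obtain ⟨Z, hZan, -, hTZ, hZval⟩ := exists_qGerm_locT_intMul W D a ha m
  obtain ⟨r, hr, hsum⟩ := exists_hasSum_taylorAt0 hZan
  have hev : ∀ᶠ q in 𝓝[≠] (0 : ℂ), HasSum (fun n : ℕ ↦ coeff n (taylorAt0 Z) * q ^ n) (Z q) := by
    have h1 : ∀ᶠ q in 𝓝 (0 : ℂ), ‖q‖ < r := by
      have : Metric.ball (0 : ℂ) r ∈ 𝓝 (0 : ℂ) := Metric.ball_mem_nhds 0 hr
      filter_upwards [this] with q hq
      rwa [Metric.mem_ball, dist_zero_right] at hq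
    exact (h1.filter_mono nhdsWithin_le_nhds).mono fun q hq ↦ hsum q hq
  obtain ⟨B, hB⟩ := exists_im_bound_of_eventually hev
  refine ⟨B, fun τ hτ ↦ ?_⟩
  have h := hB τ hτ
  rw [hTZ, hZval τ] at h
  simpa only [coeff_map, eq_ratCast] using h

/-- **(INT) Honda at the integer `m`**: every coefficient of `exp_W(m·Σ aₙqⁿ/n)` is an integer (`W` globally minimal, `aₙ = aₙ(W)`).
[cite: Honda1970, Thm. 9] [cite: SilvermanAEC2009, IV.5.5] -/
theorem exists_int_coeff_expSeries_intMul (W : WeierstrassCurve ℚ) [W.IsElliptic] [W.IsGloballyMinimal] {N : ℕ} [NeZero N]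
    (D : ModularParametrizationData W N) (a : ℕ → ℤ) (ha : ∀ n, (a n : ℂ) = cuspCoeff D.f n) (m : ℤ) (n : ℕ) :
    ∃ k : ℤ, coeff n (W.formalExp.subst ((m : ℚ) • lSeriesLog a)) = (k : ℚ) := by
  rw [MinimalCubeRoot.lSeriesLog_eq_of_cuspCoeff W D a ha]
  exact DepletionAtTwo.ParamIntegral.exists_int_coeff_formalExp_subst_lSeriesLog W m n

/-! ## §2 Periodicity: `t` is `Λ`-periodic; `t_W(c'·ℰ_f)` is `Γ^{(2)}`-invariant -/

/-- `locT` is `Λ`-periodic. [folklore] -/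
theorem locT_add_of_mem_lattice (L : PeriodPair) (V : WeierstrassCurve ℂ) {ν : ℂ} (hν : ν ∈ L.lattice) (w : ℂ) :
    locT L V (w + ν) = locT L V w := by
  have hiff : w + ν ∈ L.lattice ↔ w ∈ L.lattice :=
    ⟨fun h ↦ by simpa using L.lattice.sub_mem h hν, fun h ↦ L.lattice.add_mem h hν⟩
  by_cases hw : w ∈ L.lattice
  · rw [locT, locT, if_pos (hiff.mpr hw), if_pos hw]
  · rw [locT, locT, if_neg (fun h ↦ hw (hiff.mp h)), if_neg hw, L.weierstrassP_add_coe w ⟨ν, hν⟩,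
      L.derivWeierstrassP_add_coe w ⟨ν, hν⟩]

/-- The half point moves by a half period: `c'·ℰ_f(γτ) = c'·ℰ_f(τ) + c'·{∞,γ∞}_f` (`γ ∈ Γ₀(N)`). [cite: Manin1972, Prop. 1.4 (shape)] -/
theorem halfMul_eichlerIntegral_gamma_smul {W : WeierstrassCurve ℚ} {N : ℕ} [NeZero N] (D : ModularParametrizationData W N)
    (c' : ℂ) (γ : Gamma0 N) (τ : ℍ) :
    c' * eichlerIntegral D.f ((γ : SL(2, ℤ)) • τ) = c' * eichlerIntegral D.f τ + c' * cuspSymbol D.f γ := by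
  have h := eichlerIntegral_smul_sub_holds D.f γ τ
  linear_combination c' * h

/-- **`Γ^{(2)}`-invariance of the half-point parameter**: if `c = 2c'` and `c·{∞,γ∞}_f = 2ν` with `ν ∈ Λ_W` (i.e. `γ ∈ Γ^{(2)}`), then
`t_W(c'·ℰ_f(γτ)) = t_W(c'·ℰ_f(τ))`. [cite: Manin1972, Prop. 1.4 (shape)] -/
theorem locT_halfMul_gamma_smul {W : WeierstrassCurve ℚ} {N : ℕ} [NeZero N] (D : ModularParametrizationData W N)
    {c' : ℤ} (hc : D.c = 2 * c') (γ : Gamma0 N) {ν : ℂ} (hν : ν ∈ D.L.lattice) (hγ : (D.c : ℂ) * cuspSymbol D.f γ = 2 * ν)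
    (τ : ℍ) :
    locT D.L (W.baseChange ℂ) ((c' : ℂ) * eichlerIntegral D.f ((γ : SL(2, ℤ)) • τ)) =
      locT D.L (W.baseChange ℂ) ((c' : ℂ) * eichlerIntegral D.f τ) := by
  have h2 : (c' : ℂ) * cuspSymbol D.f γ = ν := by
    have : (D.c : ℂ) = 2 * (c' : ℂ) := by exact_mod_cast hc
    rw [this] at hγ
    have h' : (2 : ℂ) * ((c' : ℂ) * cuspSymbol D.f γ - ν) = 0 := by linear_combination hγ
    simpa [sub_eq_zero] using h'
  rw [halfMul_eichlerIntegral_gamma_smul D (c' : ℂ) γ τ, h2]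
  exact locT_add_of_mem_lattice D.L _ hν _

/-- Twice the half-period lies in the Néron lattice: `2·(c'·{∞,γ∞}_f) = c·{∞,γ∞}_f ∈ Λ_W` (`c = 2c'`, `γ ∈ Γ₀(N)`). [folklore] -/
theorem two_mul_halfMul_cuspSymbol_mem {W : WeierstrassCurve ℚ} {N : ℕ} [NeZero N] (D : ModularParametrizationData W N)
    {c' : ℤ} (hc : D.c = 2 * c') (γ : Gamma0 N) :
    2 * ((c' : ℂ) * cuspSymbol D.f γ) ∈ D.L.lattice := by
  have : (D.c : ℂ) = 2 * (c' : ℂ) := by exact_mod_cast hc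
  rw [← mul_assoc, ← this]
  exact D.smul_periodLattice_le _ (cuspSymbol_mem_periodLattice D.f γ)

end Summit.BirchSwinnertonDyer.BirchSwinnertonDyer.Theorems.ManinLocalTwoThree.HalvingParam

end
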